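import Mathlib
import Literature.Probability.LatticeModels.ProdBernoulliIndependence
import Literature.Probability.Percolation.KozmaNitzanPinning
import Literature.Probability.Percolation.ClusterBoundary
import Literature.Probability.Percolation.PercolationProofs
import Literature.Probability.Percolation.Crossings
import Summits.CriticalPhenomena.PercolationContinuityZ3.Theorems.PercNearOneGluingNoHeavyLowerTailPocketSelectionBound
import HarnessLib

/-!
# Crux `PercNearOneGluing.NoHeavyLowerTail` (stmt-CriticalPhenomena-4575), line `bhk-superadditivity-thinning` —
# sub-goal `monotoneCoverBound` (Harris on monotone covers of an admissible pocket selection)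

Helper file for the crux (lead prover-line-stmt-CriticalPhenomena-4575-0): tooling for the
residual `stub_manyFingersLargePocket`.  Proves exactly the registered sub-goal signature; lands
with `--supports stmt-CriticalPhenomena-4575`.

## Content: THE MONOTONE COVER BOUND

For `μ = prodBernoulli w` on the pairs of `Fin n`, a relay set `A`, an observer `o ∉ A`, a hub
`b ∈ A`, an *admissible* selection rule `sel` (as in the sibling `pocketSelectionBound`) and a
set-valued cover `Sel ⊇ {sel}` that is MONOTONE under inclusion,
`μ(o ↔ A, o ↮ b) ≤ Σ_a μ(a ∈ Sel(pocket)) · μ(a ↮ b)`,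
where the *relay-free pocket* of `ω` is the finset `{v | ω ∈ openConnIn (↑A)ᶜ o v}`.

Proof.  (1) `pocketSelectionBound'` bounds the left side by
`Σ_{S₀ ∋ o, S₀ ∩ A = ∅} μ(pocket = S₀, o ↔ A, sel S₀ ↮ b)`; each summand is at most
`μ(pocket = S₀, sel S₀ ↮ b) ≤ Σ_a μ(pocket = S₀, a ∈ Sel S₀, a ↮ b)` (the summand `a = sel S₀`
alone dominates since `sel S₀ ∈ Sel S₀`).  (2) Swap the two finite sums; for fixed `a` the events
`{pocket = S₀}` are pairwise disjoint, so the inner sum is the measure of a union, which lies in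
`{a ∈ Sel(pocket)} ∩ {a ↮ b}`.  (3) Harris: `{a ∈ Sel(pocket)}` is increasing (the pocket is
increasing in `ω`, `Sel` is monotone) and `{a ↮ b}` is decreasing.
-/

namespace Summit.CriticalPhenomena.PercolationContinuityZ3.Theorems

open scoped BigOperators Classical
open MeasureTheory Set
open Literature.Probability.LatticeModels (prodBernoulli prodBernoulli_harris_upper_lower)
open Literature.Probability.Percolation

/-- **The monotone cover bound** (binder form): for an admissible selection rule `sel` and a
monotone set-valued cover `Sel` with `sel S₀ ∈ Sel S₀`,
`μ(o ↔ A, o ↮ b) ≤ Σ_a μ(a ∈ Sel(pocket)) · μ(a ↮ b)`.  Pocket selection bound, domination of each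
pocket term by the `Sel`-cover, re-assembly of the pocket partition, and Harris' inequality for the
increasing event `{a ∈ Sel(pocket)}` and the decreasing event `{a ↮ b}`. -/
theorem monotoneCoverBound' (n : ℕ) (w : Sym2 (Fin n) → unitInterval) (A : Finset (Fin n))
    (o b : Fin n) (sel : Finset (Fin n) → Fin n) (Sel : Finset (Fin n) → Finset (Fin n))
    (hoA : o ∉ A) (hb : b ∈ A)
    (hmono : ∀ S₀ S₁ : Finset (Fin n), S₀ ⊆ S₁ → Sel S₀ ⊆ Sel S₁)
    (hsel : ∀ S₀ : Finset (Fin n), sel S₀ ∈ Sel S₀)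
    (hadm : ∀ S₀ : Finset (Fin n), o ∈ S₀ → Disjoint S₀ A → ∀ v ∈ A, (∃ x ∈ S₀, w s(x, v) ≠ 0) →
      (prodBernoulli (pinW w (edgesTouching (↑S₀ : Set (Fin n))) (∅ : Set (Sym2 (Fin n))))).real
          (openConn (sel S₀) b) ≤
        (prodBernoulli (pinW w (edgesTouching (↑S₀ : Set (Fin n))) (∅ : Set (Sym2 (Fin n))))).real
          (openConn v b)) :
    (prodBernoulli w).real ((⋃ a ∈ A, openConn o a) ∩ (openConn o b)ᶜ) ≤
      ∑ a : Fin n, (prodBernoulli w).real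
          {ω | a ∈ Sel (Finset.univ.filter fun v => ω ∈ openConnIn (↑A : Set (Fin n))ᶜ o v)} *
        (prodBernoulli w).real (openConn a b)ᶜ := by
  set μ := prodBernoulli w with hμ
  -- the pocket partition, the cover events, the per-pocket cover terms
  set Pock : Finset (Fin n) → Set (Set (Sym2 (Fin n))) :=
    fun S₀ => {ω | ∀ v : Fin n, ω ∈ openConnIn (↑A : Set (Fin n))ᶜ o v ↔ v ∈ S₀} with hPock
  set U : Fin n → Set (Set (Sym2 (Fin n))) := fun a =>
    {ω | a ∈ Sel (Finset.univ.filter fun v => ω ∈ openConnIn (↑A : Set (Fin n))ᶜ o v)} with hUdef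
  set T : Finset (Fin n) → Fin n → Set (Set (Sym2 (Fin n))) :=
    fun S₀ a => Pock S₀ ∩ ({_ω | a ∈ Sel S₀} ∩ (openConn a b)ᶜ) with hT
  set F : Finset (Finset (Fin n)) :=
    (Finset.univ : Finset (Finset (Fin n))).filter (fun S₀ => o ∈ S₀ ∧ Disjoint S₀ A) with hF
  -- (1) the pocket selection bound, and domination of each pocket term by the cover terms
  have h1 := pocketSelectionBound' n w A o b sel hoA hb hadm
  have hstep1 : ∀ S₀ : Finset (Fin n),
      μ.real (Pock S₀ ∩ ((⋃ a ∈ A, openConn o a) ∩ (openConn (sel S₀) b)ᶜ)) ≤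
        ∑ a : Fin n, μ.real (T S₀ a) := by
    intro S₀
    calc μ.real (Pock S₀ ∩ ((⋃ a ∈ A, openConn o a) ∩ (openConn (sel S₀) b)ᶜ))
        ≤ μ.real (T S₀ (sel S₀)) :=
          measureReal_mono (fun ω ⟨hP, _, hC⟩ => ⟨hP, hsel S₀, hC⟩) (measure_ne_top _ _)
      _ ≤ ∑ a : Fin n, μ.real (T S₀ a) :=
          Finset.single_le_sum (f := fun a => μ.real (T S₀ a)) (fun _ _ => measureReal_nonneg)
            (Finset.mem_univ (sel S₀))
  -- (2) re-assembly of the pocket partition inside the cover event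
  have hstep2 : ∀ a : Fin n, ∑ S₀ ∈ F, μ.real (T S₀ a) ≤ μ.real (U a ∩ (openConn a b)ᶜ) := by
    intro a
    have hd : PairwiseDisjoint (↑F : Set (Finset (Fin n))) (fun S₀ => T S₀ a) := by
      intro S₀ _ S₁ _ hne
      refine Set.disjoint_left.2 fun ω h0 h1 => hne (Finset.ext fun v => ?_)
      exact (h0.1 v).symm.trans (h1.1 v)
    rw [← measureReal_biUnion_finset hd (fun _ _ => MeasurableSet.of_discrete)]
    refine measureReal_mono ?_ (measure_ne_top _ _)
    intro ω hω
    simp only [mem_iUnion, exists_prop] at hω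
    obtain ⟨S₀, -, hP, haS, hC⟩ := hω
    have hpk : (Finset.univ.filter fun v => ω ∈ openConnIn (↑A : Set (Fin n))ᶜ o v) = S₀ :=
      Finset.ext fun v => by
        simp only [Finset.mem_filter, Finset.mem_univ, true_and]
        exact hP v
    refine ⟨?_, hC⟩
    show a ∈ Sel (Finset.univ.filter fun v => ω ∈ openConnIn (↑A : Set (Fin n))ᶜ o v)
    rw [hpk]
    exact haS
  -- (3) Harris: the cover event is increasing, the disconnection event is decreasing
  have hstep3 : ∀ a : Fin n,
      μ.real (U a ∩ (openConn a b)ᶜ) ≤ μ.real (U a) * μ.real (openConn a b)ᶜ := by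
    intro a
    have hU : IsUpperSet (U a) := by
      intro ω ω' hle hω
      refine hmono _ _ (fun v hv => ?_) hω
      simp only [Finset.mem_filter, Finset.mem_univ, true_and] at hv ⊢
      exact isUpperSet_openConnIn _ _ _ hle hv
    exact prodBernoulli_harris_upper_lower w hU (isUpperSet_openConn a b).compl
      MeasurableSet.of_discrete MeasurableSet.of_discrete
  -- assemble
  calc μ.real ((⋃ a ∈ A, openConn o a) ∩ (openConn o b)ᶜ)
      ≤ ∑ S₀ ∈ F, μ.real (Pock S₀ ∩ ((⋃ a ∈ A, openConn o a) ∩ (openConn (sel S₀) b)ᶜ)) := h1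
    _ ≤ ∑ S₀ ∈ F, ∑ a : Fin n, μ.real (T S₀ a) := Finset.sum_le_sum fun S₀ _ => hstep1 S₀
    _ = ∑ a : Fin n, ∑ S₀ ∈ F, μ.real (T S₀ a) := Finset.sum_comm
    _ ≤ ∑ a : Fin n, μ.real (U a ∩ (openConn a b)ᶜ) := Finset.sum_le_sum fun a _ => hstep2 a
    _ ≤ ∑ a : Fin n, μ.real (U a) * μ.real (openConn a b)ᶜ :=
        Finset.sum_le_sum fun a _ => hstep3 a

/-- **Registered sub-goal `monotoneCoverBound` of crux stmt-CriticalPhenomena-4575** (verbatim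
signature, fully qualified): THE MONOTONE COVER BOUND — for an admissible selection rule `sel`
(for every pocket shape `S₀ ∋ o` disjoint from `A` and every relay point `v ∈ A` joined to `S₀`
by a positive-weight pair, `P_{G−S₀}(sel S₀ ↔ b) ≤ P_{G−S₀}(v ↔ b)`) and a monotone set-valued
cover `Sel` with `sel S₀ ∈ Sel S₀`, `μ(o ↔ A, o ↮ b) ≤ Σ_a μ(a ∈ Sel(pocket)) · μ(a ↮ b)`.
See `monotoneCoverBound'`. -/
theorem monotoneCoverBound :
    ∀ (n : ℕ) (w : Sym2 (Fin n) → unitInterval) (A : Finset (Fin n)) (o b : Fin n) (sel : Finset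
    (Fin n) → Fin n) (Sel : Finset (Fin n) → Finset (Fin n)), o ∉ A → b ∈ A → (∀ S₀ S₁ : Finset
    (Fin n), S₀ ⊆ S₁ → Sel S₀ ⊆ Sel S₁) → (∀ S₀ : Finset (Fin n), sel S₀ ∈ Sel S₀) → (∀ S₀ :
    Finset (Fin n), o ∈ S₀ → Disjoint S₀ A → ∀ v ∈ A, (∃ x ∈ S₀, w s(x, v) ≠ 0) →
    (Literature.Probability.LatticeModels.prodBernoulli (Literature.Probability.Percolation.pinW w
    (Literature.Probability.Percolation.edgesTouching (↑S₀ : Set (Fin n))) (∅ : Set (Sym2 (Fin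
    n))))).real (Literature.Probability.Percolation.openConn (sel S₀) b) ≤
    (Literature.Probability.LatticeModels.prodBernoulli (Literature.Probability.Percolation.pinW w
    (Literature.Probability.Percolation.edgesTouching (↑S₀ : Set (Fin n))) (∅ : Set (Sym2 (Fin
    n))))).real (Literature.Probability.Percolation.openConn v b)) →
    (Literature.Probability.LatticeModels.prodBernoulli w).real ((⋃ a ∈ A,
    Literature.Probability.Percolation.openConn o a) ∩ (Literature.Probability.Percolation.openConn
    o b)ᶜ) ≤ ∑ a : Fin n, (Literature.Probability.LatticeModels.prodBernoulli w).real {ω | a ∈ Sel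
    (Finset.univ.filter fun v => ω ∈ Literature.Probability.Percolation.openConnIn (↑A : Set (Fin
    n))ᶜ o v)} * (Literature.Probability.LatticeModels.prodBernoulli w).real
    (Literature.Probability.Percolation.openConn a b)ᶜ :=
  fun n w A o b sel Sel ho hb hmono hsel hadm =>
    monotoneCoverBound' n w A o b sel Sel ho hb hmono hsel hadm

end Summit.CriticalPhenomena.PercolationContinuityZ3.Theorems
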